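/-
Copyright (c) 2026 the pub-hodgecm-mathlib formalisation cell (harness21).  Prover seat hodgecm-mathlib-K2E3-p03 (g2), HCML Track B «K2-LIT» (build stream 29),
h413 = `stmt-HodgeConjecture-24833`, line `K2_E3_EllipticInputs`, unit U3, line U3-d (lead K2E3-p03): THE PAYER OF SOCKET #3H `sig_K2E3ShalikaGermHomogeneityRay`.  2026-09-04.
-/
import Summits.HodgeConjecture.HodgeConjecture.Theorems.K2E3ShalikaGermHomogeneityOfUnipotentScaling   -- ★ p855276 (K2E3-p03 g0): ‹Ψ-package› → ‹#3H*›; brings ★ p855211 ‹#3H*› → ‹#3H›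
import Summits.HodgeConjecture.HodgeConjecture.Theorems.K2E3CayleyScalingPackage                       -- ★ p855512 (K2E3-p01): ‹SC-explicit› → ‹Ψ-package›
import Summits.HodgeConjecture.HodgeConjecture.Theorems.K2E3UnipotentOrbitalScalingLawOfNeZero               -- ★ p856049 (K2E3-p21 g2): ‹C1, (2:K) ≠ 0 shape› → ‹SC-explicit› (FILE C assembly, payable form)  [ED. 2]
import Summits.HodgeConjecture.HodgeConjecture.Theorems.K2E3UnipotentOrbitalScalingTransvectionDyadicHaar    -- ★ p856078 (K2E4-p03 g2): rung C1 at principal level 2, `exists_haar_index_identity_of_transvection_of_two_ne_zero` = ‹C1₂› PAID  [ED. 3]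
import HarnessLib

/-!
# h413 ∕ Track B «K2-LIT», line `K2_E3_EllipticInputs`, unit U3, line U3-d: HOMOGENEITY OF THE NON-TRIVIAL SHALIKA GERMS ALONG ONE RAY OF A TYPE-(3) TORUS —
# socket #3H `U3CubicGerms.sig_K2E3ShalikaGermHomogeneityRay` FROM THE SCALING LAW OF THE UNIPOTENT ORBITAL INTEGRALS (Rogawski 1990 Prop. 8.1.2 (b); Harish-Chandra 1999 Lemma 3.2, Thm. 8.1)

Cell `pub/hodgecm-mathlib`, crux H413 = `stmt-HodgeConjecture-24833`, route of record `HCCMUnconditional`; chair K2-lead, dealer K2E3-plan (g1), U3-d line lead K2E3-p03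
(g0 → g2).  THEOREMS ONLY (no `def`, no `instance`, no `notation`, no `sorry`); imports = ★ + HarnessLib; lane `--supports stmt-HodgeConjecture-24833 --as helper`.

THE STATEMENT.  `shalikaGermHomogeneityRay_of_scalingLaw : ‹SC-explicit› → ‹#3H›`: the hypothesis is TOKEN FOR TOKEN the hypothesis `hSC` of ★ p855512
`K2E3CayleyScalingPackage.psiPackage_of_scalingLaw` (= the conclusion of the U3-d assembly `K2E3UnipotentOrbitalScalingLaw`, FILE C), the conclusion is TOKEN FOR TOKEN the
socket U3-d ∕ #3H `K2E3EllipticInputs.U3CubicGerms.sig_K2E3ShalikaGermHomogeneityRay` (`Cruxes/H413/Lines/K2_E3_EllipticInputsSigs_U3CubicGerms.lean` ED. 2 :101–126) with the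
Lines-side reducible `abbrev Pl L := HeightOneSpectrum (𝓞 L⁺)` inlined (the tie is `rfl`): for the canonical family `mQv` at a non-split `v`, a compact Cartan `T = Z(γ₀)` of
type (3) and EVERY expansion datum `(S, mU, Γ)` at `1`, a sequence of regular `γ_n ∈ T`, `γ_n → 1`, `‖q‖ > 1`, `a u ≥ 1`, `g u`, `n₀` with `Γ u [γ_n] = q^{n·a u}·g u`
(`n ≥ n₀`, `u ∈ S ∖ {[1]}`).

THE PROOF = THE U3-d CHAIN (road H-a′ of the line-lead memo, every link ★): ‹SC-explicit› ⟹ ‹Ψ-package› (★ p855512 `psiPackage_of_scalingLaw`: the Cayley scaling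
`Ψ = c ∘ (s·) ∘ c⁻¹` on the eigenvalue ball `U₀`, equivariant, centraliser- and regularity-preserving, contracting, and scaling the unipotent orbital integrals by `q^{a u}`)
⟹ ‹#3H*› (★ p855276 `shalikaGermHomogeneityRayRef_of_unipotentScaling`: the Howe expansion datum of the canonical family + its DUAL pieces; expanding `1_{U₀}·(f^∨_u ∘ Ψ)`
kills the cross terms and gives `Γ_u([Ψγ]) = q^{a u}·Γ_u([γ])`, hence pure exponentials along the Ψ-orbit of one regular point of `T ∩ U₀`) ⟹ ‹#3H› (★ p855211
`shalikaGermHomogeneityRay_of_reference`: any two admissible data have proportional germs near `1` — dual pieces for the combined family + ★ `smulInvariantMeasure_quotient_unique`).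
Print: Harish-Chandra's dilation `f_t(X) = f(t⁻¹X)` read on the group through the Cayley chart is the mechanism behind [Rogawski1990] Prop. 8.1.2 (b)
«`Γ_u(exp(t²Y)γ) = |t|^{−d(u)} Γ_u(exp(Y)γ)`» ([HarishChandra1999] §3.1 Lemma 3.2, Thm. 8.1 (1) «`Γ_O(t²H) = |t|^{r(O)−ℓ} Γ_O(H)`»).

HONEST LABEL.  HC_CM is proved only modulo the 7 printed citations (2 remaining named inputs: hLiu418 = `stmt-HodgeConjecture-24832`, h413 =
`stmt-HodgeConjecture-24833`) until rung 0 closes.  This file is count-neutral by itself: #3 ⟸ (★ p855129) #3H ⟸ (this file) ‹SC-explicit› = FILE C's assembly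
`K2E3UnipotentOrbitalScalingLaw` (K2E3-p21 (g2)) ⟸ the C1 dyadic residual (K2E4-p03 (g2)); the unconditional payer `shalikaGermHomogeneityRay : ‹#3H›` is appended (ED. 2)
the moment the assembly lands.

## References
* [Rogawski1990] J. D. Rogawski, *Automorphic Representations of Unitary Groups in Three Variables*, Ann. of Math. Stud. 123 (1990), §8.1 Prop. 8.1.1 pp. 112–113,
  Prop. 8.1.2 (b) p. 114, (8.1.1) p. 116; §12.7 p. 194.
* [HarishChandra1999AdmissibleDistributions] Harish-Chandra (notes by S. DeBacker and P. J. Sally, Jr.), *Admissible Invariant Distributions on Reductive p-adic Groups*,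
  AMS ULS 16 (1999), §3.1 Lemma 3.2; Thm. 8.1 p. 48.
-/

set_option autoImplicit false
-- the mandated namespace repeats the single-problem summit's segment (`HodgeConjecture.HodgeConjecture`), as in every `Theorems/*.lean` of this sub-problem
set_option linter.dupNamespace false

noncomputable section

open NumberField IsDedekindDomain MeasureTheory Filter Topology Set
open scoped Matrix MatrixGroups
open Literature.NumberTheory.Rogawski1990 Literature.NumberTheory.Automorphic Literature.NumberTheory.Automorphic.UnitaryGroup
open Literature.NumberTheory.Weil1982.UnitaryFinTopForm Literature.NumberTheory.Rogawski1990.TypeThreeTorus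
open Summit.HodgeConjecture.HodgeConjecture.Cruxes.H413.K2E3ShalikaGermHomogeneityRayOfReference
open Summit.HodgeConjecture.HodgeConjecture.Cruxes.H413.K2E3ShalikaGermHomogeneityOfUnipotentScaling
open Summit.HodgeConjecture.HodgeConjecture.Cruxes.H413.K2E3CayleyScalingPackage

namespace Summit.HodgeConjecture.HodgeConjecture.Cruxes.H413.K2E3ShalikaGermHomogeneityRay

set_option maxHeartbeats 3200000 in  -- statement-level `whnf` on the CM carriers (the U3 socket frame + the ‹SC-explicit› frame)
set_option synthInstance.maxHeartbeats 400000 in  -- idem (the socket module's own budget line)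
open scoped Classical in
/-- **HOMOGENEITY OF THE NON-TRIVIAL SHALIKA GERMS ALONG ONE RAY OF A TYPE-(3) TORUS FROM THE SCALING LAW OF THE UNIPOTENT ORBITAL INTEGRALS: `‹SC-explicit› → ‹#3H›`.**
Hypothesis = `hSC` of ★ p855512 `psiPackage_of_scalingLaw` token for token; conclusion = socket #3H `U3CubicGerms.sig_K2E3ShalikaGermHomogeneityRay` token for token (`Pl L`
inlined).  Proof: the U3-d chain ★ p855211 ∘ ★ p855276 ∘ ★ p855512 (see the module docstring).
[cite: Rogawski1990, §8.1 Prop. 8.1.2 (b) p. 114; Prop. 8.1.1 pp. 112–113; (8.1.1) p. 116] [cite: HarishChandra1999AdmissibleDistributions, §3.1 Lemma 3.2; Thm. 8.1 p. 48] -/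
theorem shalikaGermHomogeneityRay_of_scalingLaw
    (hSC : ∀ (L : Type) [Field L] [NumberField L] [IsCMField L] (v : HeightOneSpectrum (𝓞 ↥(maximalRealSubfield L))),
      (∀ w : PlacesOver L v, IsCMField.complexConj L • w.1 = w.1) →
      ∀ [MeasurableSpace (Gqs L v)] [BorelSpace (Gqs L v)]
        [∀ γ : Gqs L v, MeasurableSpace (Gqs L v ⧸ Subgroup.centralizer ({γ} : Set (Gqs L v)))]
        [∀ γ : Gqs L v, BorelSpace (Gqs L v ⧸ Subgroup.centralizer ({γ} : Set (Gqs L v)))],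
      ∃ (w : PlacesOver L v) (hw : IsCMField.complexConj L • w.1 = w.1) (s : w.1.adicCompletion L) (ρ : ℝ) (q : ℂ) (a : ConjClasses (Gqs L v) → ℕ),
        galAdicCompletionMap (L := L) (IsCMField.complexConj L) hw s = s ∧ s ≠ 0 ∧ ‖s‖ < 1 ∧ 0 < ρ ∧ ρ < 1 ∧ 1 < ‖q‖ ∧
        (∀ u : ConjClasses (Gqs L v), u ≠ ConjClasses.mk 1 → 1 ≤ a u) ∧
        ∀ (Ψ : Gqs L v → Gqs L v) (U₀ : Set (Gqs L v)),
          (∀ γ : Gqs L v, γ ∈ U₀ ↔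
            IsUnit ((((localNonsplitEquiv (IsCMField.complexConj L) (qsForm L) (IsCMField.complexConj_ne_one L) w hw γ : ↥(unitaryGroupOfForm (galAdicCompletionMap (L := L) (IsCMField.complexConj L) hw) (placeForm (qsForm L) w.1))) : GL (Fin 3) (w.1.adicCompletion L)) : Matrix (Fin 3) (Fin 3) (w.1.adicCompletion L)) + 1).det ∧
            ‖(((((localNonsplitEquiv (IsCMField.complexConj L) (qsForm L) (IsCMField.complexConj_ne_one L) w hw γ : ↥(unitaryGroupOfForm (galAdicCompletionMap (L := L) (IsCMField.complexConj L) hw) (placeForm (qsForm L) w.1))) : GL (Fin 3) (w.1.adicCompletion L)) : Matrix (Fin 3) (Fin 3) (w.1.adicCompletion L)) - 1) *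
                ((((localNonsplitEquiv (IsCMField.complexConj L) (qsForm L) (IsCMField.complexConj_ne_one L) w hw γ : ↥(unitaryGroupOfForm (galAdicCompletionMap (L := L) (IsCMField.complexConj L) hw) (placeForm (qsForm L) w.1))) : GL (Fin 3) (w.1.adicCompletion L)) : Matrix (Fin 3) (Fin 3) (w.1.adicCompletion L)) + 1)⁻¹).charpoly.coeff 2‖ ≤ ρ ∧
            ‖(((((localNonsplitEquiv (IsCMField.complexConj L) (qsForm L) (IsCMField.complexConj_ne_one L) w hw γ : ↥(unitaryGroupOfForm (galAdicCompletionMap (L := L) (IsCMField.complexConj L) hw) (placeForm (qsForm L) w.1))) : GL (Fin 3) (w.1.adicCompletion L)) : Matrix (Fin 3) (Fin 3) (w.1.adicCompletion L)) - 1) *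
                ((((localNonsplitEquiv (IsCMField.complexConj L) (qsForm L) (IsCMField.complexConj_ne_one L) w hw γ : ↥(unitaryGroupOfForm (galAdicCompletionMap (L := L) (IsCMField.complexConj L) hw) (placeForm (qsForm L) w.1))) : GL (Fin 3) (w.1.adicCompletion L)) : Matrix (Fin 3) (Fin 3) (w.1.adicCompletion L)) + 1)⁻¹).charpoly.coeff 1‖ ≤ ρ ^ 2 ∧
            ‖(((((localNonsplitEquiv (IsCMField.complexConj L) (qsForm L) (IsCMField.complexConj_ne_one L) w hw γ : ↥(unitaryGroupOfForm (galAdicCompletionMap (L := L) (IsCMField.complexConj L) hw) (placeForm (qsForm L) w.1))) : GL (Fin 3) (w.1.adicCompletion L)) : Matrix (Fin 3) (Fin 3) (w.1.adicCompletion L)) - 1) *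
                ((((localNonsplitEquiv (IsCMField.complexConj L) (qsForm L) (IsCMField.complexConj_ne_one L) w hw γ : ↥(unitaryGroupOfForm (galAdicCompletionMap (L := L) (IsCMField.complexConj L) hw) (placeForm (qsForm L) w.1))) : GL (Fin 3) (w.1.adicCompletion L)) : Matrix (Fin 3) (Fin 3) (w.1.adicCompletion L)) + 1)⁻¹).charpoly.coeff 0‖ ≤ ρ ^ 3) →
          (∀ γ ∈ U₀,
            (((localNonsplitEquiv (IsCMField.complexConj L) (qsForm L) (IsCMField.complexConj_ne_one L) w hw (Ψ γ) : ↥(unitaryGroupOfForm (galAdicCompletionMap (L := L) (IsCMField.complexConj L) hw) (placeForm (qsForm L) w.1))) : GL (Fin 3) (w.1.adicCompletion L)) : Matrix (Fin 3) (Fin 3) (w.1.adicCompletion L)) =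
              cayley (s • (((((localNonsplitEquiv (IsCMField.complexConj L) (qsForm L) (IsCMField.complexConj_ne_one L) w hw γ : ↥(unitaryGroupOfForm (galAdicCompletionMap (L := L) (IsCMField.complexConj L) hw) (placeForm (qsForm L) w.1))) : GL (Fin 3) (w.1.adicCompletion L)) : Matrix (Fin 3) (Fin 3) (w.1.adicCompletion L)) - 1) *
                ((((localNonsplitEquiv (IsCMField.complexConj L) (qsForm L) (IsCMField.complexConj_ne_one L) w hw γ : ↥(unitaryGroupOfForm (galAdicCompletionMap (L := L) (IsCMField.complexConj L) hw) (placeForm (qsForm L) w.1))) : GL (Fin 3) (w.1.adicCompletion L)) : Matrix (Fin 3) (Fin 3) (w.1.adicCompletion L)) + 1)⁻¹))) →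
          ∀ (S : Finset (ConjClasses (Gqs L v))) (mU : OrbitalMeasureFamily (Gqs L v)),
            (∀ u ∈ S, (((Quotient.out u : Gqs L v).val : GL (Fin 3) (UnitaryGroup.LocalRing L v)).val - 1) ^ 3 = 0) →
            mU.IsAdmissibleOn (fun γ : Gqs L v => (ConjClasses.mk γ) ∈ S) →
            ∀ u ∈ S, ∀ F : Gqs L v → ℂ, IsLocSmooth F →
              classOrbitalIntegral mU (U₀.indicator (F ∘ Ψ)) u = q ^ (a u) * classOrbitalIntegral mU F u) :
    ∀ (L : Type) [Field L] [NumberField L] [IsCMField L] (v : HeightOneSpectrum (𝓞 ↥(maximalRealSubfield L))),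
      (∀ w : PlacesOver L v, IsCMField.complexConj L • w.1 = w.1) →
      ∀ [MeasurableSpace (Gqs L v)] [BorelSpace (Gqs L v)]
        [∀ γ : Gqs L v, MeasurableSpace (Gqs L v ⧸ Subgroup.centralizer ({γ} : Set (Gqs L v)))]
        [∀ γ : Gqs L v, BorelSpace (Gqs L v ⧸ Subgroup.centralizer ({γ} : Set (Gqs L v)))]
        (νQv : Measure (Gqs L v)) [νQv.IsHaarMeasure] [νQv.IsMulRightInvariant]
        (mQv : OrbitalMeasureFamily (Gqs L v)),
        mQv.IsCanonical (fun γ => IsRegularElt (γ.val : GL (Fin 3) (UnitaryGroup.LocalRing L v))) νQv →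
        ∀ (T : Subgroup (Gqs L v)), IsCompact ((T : Subgroup (Gqs L v)) : Set (Gqs L v)) →
        ∀ (γ₀ : Gqs L v), IsRegularElt (γ₀.val : GL (Fin 3) (UnitaryGroup.LocalRing L v)) → T = Subgroup.centralizer ({γ₀} : Set (Gqs L v)) →
        (∀ γ ∈ T, IsRegularElt (γ.val : GL (Fin 3) (UnitaryGroup.LocalRing L v)) → ∀ c : UnitaryGroup.LocalRing L v, ¬ ((γ.val.val : Matrix (Fin 3) (Fin 3) (UnitaryGroup.LocalRing L v)).charpoly).IsRoot c) →
        ∀ (S : Finset (ConjClasses (Gqs L v))) (mU : OrbitalMeasureFamily (Gqs L v)) (Γ : ConjClasses (Gqs L v) → ConjClasses (Gqs L v) → ℂ),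
          (∀ u ∈ S, (((Quotient.out u : Gqs L v).val : GL (Fin 3) (UnitaryGroup.LocalRing L v)).val - 1) ^ 3 = 0) →
          mU.IsAdmissibleOn (fun γ : Gqs L v => (ConjClasses.mk γ) ∈ S) →
          (∀ f : Gqs L v → ℂ, IsLocSmooth f →
            ∃ W ∈ 𝓝 (fun i : Fin 3 => ((1 : Matrix (Fin 3) (Fin 3) (UnitaryGroup.LocalRing L v)).charpoly).coeff i),
              ∀ c : ConjClasses (Gqs L v),
                IsRegularElt ((Quotient.out c : Gqs L v).val : GL (Fin 3) (UnitaryGroup.LocalRing L v)) →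
                (fun i : Fin 3 => ((Quotient.out c : Gqs L v).val : GL (Fin 3) (UnitaryGroup.LocalRing L v)).val.charpoly.coeff i) ∈ W →
                  classOrbitalIntegral mQv f c = ∑ u ∈ S, classOrbitalIntegral mU f u * Γ u c) →
          ∃ (γseq : ℕ → Gqs L v) (q : ℂ) (a : ConjClasses (Gqs L v) → ℕ) (g : ConjClasses (Gqs L v) → ℂ) (n₀ : ℕ),
            (∀ n, γseq n ∈ (T : Set (Gqs L v)) ∧ IsRegularElt ((γseq n).val : GL (Fin 3) (UnitaryGroup.LocalRing L v))) ∧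
            Tendsto γseq atTop (𝓝 (1 : Gqs L v)) ∧ 1 < ‖q‖ ∧
            (∀ u ∈ S, u ≠ ConjClasses.mk 1 → 1 ≤ a u) ∧
            ∀ u ∈ S, u ≠ ConjClasses.mk 1 → ∀ n, n₀ ≤ n → Γ u (ConjClasses.mk (γseq n)) = q ^ (n * a u) * g u :=
  shalikaGermHomogeneityRay_of_reference (shalikaGermHomogeneityRayRef_of_unipotentScaling (psiPackage_of_scalingLaw hSC))

set_option maxHeartbeats 3200000 in  -- statement-level `whnf` on the CM carriers (the U3 socket frame + the ‹C1₂› letter)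
set_option synthInstance.maxHeartbeats 400000 in  -- idem
open Summit.HodgeConjecture.HodgeConjecture.Cruxes.H413.K2E3UnipotentOrbitalScalingLawOfNeZero in  -- [ED. 2]
open scoped Classical ENNReal NNReal Valued WithZero in
/-- **ED. 2 · HOMOGENEITY OF THE NON-TRIVIAL SHALIKA GERMS ALONG ONE RAY OF A TYPE-(3) TORUS FROM THE LEVEL-2 TRANSVECTION HAAR-INDEX IDENTITY: `‹C1₂› → ‹#3H›`.**
Hypothesis = `hC1` of ★ p856049 `scalingLaw_of_transvectionHaar` token for token (★ p855803's C1 statement with `hv2 : Valued.v 2 = 1` ↦ `h2 : (2 : K) ≠ 0`); conclusion = socket #3H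
`U3CubicGerms.sig_K2E3ShalikaGermHomogeneityRay` token for token (`Pl L` inlined).  Proof: ED. 1 ∘ ★ p856049.
[cite: Rogawski1990, §8.1 Prop. 8.1.2 (b) p. 114; §3.9 p. 32] [cite: HarishChandra1999AdmissibleDistributions, §3.1 Lemma 3.2; Thm. 8.1 p. 48] -/
theorem shalikaGermHomogeneityRay_of_transvectionHaar
    (hC1 : ∀ {K : Type} [Field K] [Valued K ℤᵐ⁰] (σ : K →+* K) {J : Matrix (Fin 3) (Fin 3) K} [CompactSpace 𝒪[K]] [LocallyCompactSpace K]
      [MeasurableSpace ↥(unitaryGroupOfForm σ J)] [BorelSpace ↥(unitaryGroupOfForm σ J)],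
      J = (StdForm.antidiagonal 3).over K → (∀ a : K, σ (σ a) = a) → (∀ a : K, Valued.v (σ a) = Valued.v a) → (2 : K) ≠ 0 →
      ∀ {t : K}, t ≠ 0 → σ t = t → Valued.v t ≤ 1 →
      ∀ {O : AddSubgroup K}, (∀ x : K, x ∈ O ↔ Valued.v x ≤ 1) → ∀ {Om : AddSubgroup K}, (∀ x : K, x ∈ Om ↔ σ x = -x ∧ Valued.v x ≤ 1) →
      ∀ {Q : ℕ}, (O.map (AddMonoidHom.mulLeft t)).relIndex O = Q → (Om.map (AddMonoidHom.mulLeft (t * t))).relIndex Om = Q →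
      ∀ (u₀ : ↥(unitaryGroupOfForm σ J)), (((u₀ : GL (Fin 3) K) : Matrix (Fin 3) (Fin 3) K) - 1) * (((u₀ : GL (Fin 3) K) : Matrix (Fin 3) (Fin 3) K) - 1) = 0 → ((u₀ : GL (Fin 3) K) : Matrix (Fin 3) (Fin 3) K) ≠ 1 →
      ∃ h : ↥(unitaryGroupOfForm σ J),
        (((h * u₀ * h⁻¹ : ↥(unitaryGroupOfForm σ J)) : GL (Fin 3) K) : Matrix (Fin 3) (Fin 3) K) = cayley ((t * t) • ((((u₀ : GL (Fin 3) K) : Matrix (Fin 3) (Fin 3) K) - 1) * (((u₀ : GL (Fin 3) K) : Matrix (Fin 3) (Fin 3) K) + 1)⁻¹)) ∧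
        (∀ z : ↥(unitaryGroupOfForm σ J), z ∈ Subgroup.centralizer ({u₀} : Set ↥(unitaryGroupOfForm σ J)) ↔
          h * z * h⁻¹ ∈ Subgroup.centralizer ({u₀} : Set ↥(unitaryGroupOfForm σ J))) ∧
        ∃ K₀ : Subgroup ↥(unitaryGroupOfForm σ J), IsOpen (K₀ : Set ↥(unitaryGroupOfForm σ J)) ∧ IsCompact (K₀ : Set ↥(unitaryGroupOfForm σ J)) ∧
          ∃ ρ : Measure ↥(Subgroup.centralizer ({u₀} : Set ↥(unitaryGroupOfForm σ J))),
            ρ.IsMulLeftInvariant ∧ IsFiniteMeasureOnCompacts ρ ∧ ρ.IsOpenPosMeasure ∧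
            (((Q : ℝ≥0) ^ 2 : ℝ≥0) : ℝ≥0∞) * ρ (Subtype.val ⁻¹' ((K₀.map (MulAut.conj h).toMonoidHom : Subgroup ↥(unitaryGroupOfForm σ J)) : Set ↥(unitaryGroupOfForm σ J))) =
              ρ (Subtype.val ⁻¹' (K₀ : Set ↥(unitaryGroupOfForm σ J)))) :
    ∀ (L : Type) [Field L] [NumberField L] [IsCMField L] (v : HeightOneSpectrum (𝓞 ↥(maximalRealSubfield L))),
      (∀ w : PlacesOver L v, IsCMField.complexConj L • w.1 = w.1) →
      ∀ [MeasurableSpace (Gqs L v)] [BorelSpace (Gqs L v)]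
        [∀ γ : Gqs L v, MeasurableSpace (Gqs L v ⧸ Subgroup.centralizer ({γ} : Set (Gqs L v)))]
        [∀ γ : Gqs L v, BorelSpace (Gqs L v ⧸ Subgroup.centralizer ({γ} : Set (Gqs L v)))]
        (νQv : Measure (Gqs L v)) [νQv.IsHaarMeasure] [νQv.IsMulRightInvariant]
        (mQv : OrbitalMeasureFamily (Gqs L v)),
        mQv.IsCanonical (fun γ => IsRegularElt (γ.val : GL (Fin 3) (UnitaryGroup.LocalRing L v))) νQv →
        ∀ (T : Subgroup (Gqs L v)), IsCompact ((T : Subgroup (Gqs L v)) : Set (Gqs L v)) →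
        ∀ (γ₀ : Gqs L v), IsRegularElt (γ₀.val : GL (Fin 3) (UnitaryGroup.LocalRing L v)) → T = Subgroup.centralizer ({γ₀} : Set (Gqs L v)) →
        (∀ γ ∈ T, IsRegularElt (γ.val : GL (Fin 3) (UnitaryGroup.LocalRing L v)) → ∀ c : UnitaryGroup.LocalRing L v, ¬ ((γ.val.val : Matrix (Fin 3) (Fin 3) (UnitaryGroup.LocalRing L v)).charpoly).IsRoot c) →
        ∀ (S : Finset (ConjClasses (Gqs L v))) (mU : OrbitalMeasureFamily (Gqs L v)) (Γ : ConjClasses (Gqs L v) → ConjClasses (Gqs L v) → ℂ),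
          (∀ u ∈ S, (((Quotient.out u : Gqs L v).val : GL (Fin 3) (UnitaryGroup.LocalRing L v)).val - 1) ^ 3 = 0) →
          mU.IsAdmissibleOn (fun γ : Gqs L v => (ConjClasses.mk γ) ∈ S) →
          (∀ f : Gqs L v → ℂ, IsLocSmooth f →
            ∃ W ∈ 𝓝 (fun i : Fin 3 => ((1 : Matrix (Fin 3) (Fin 3) (UnitaryGroup.LocalRing L v)).charpoly).coeff i),
              ∀ c : ConjClasses (Gqs L v),
                IsRegularElt ((Quotient.out c : Gqs L v).val : GL (Fin 3) (UnitaryGroup.LocalRing L v)) →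
                (fun i : Fin 3 => ((Quotient.out c : Gqs L v).val : GL (Fin 3) (UnitaryGroup.LocalRing L v)).val.charpoly.coeff i) ∈ W →
                  classOrbitalIntegral mQv f c = ∑ u ∈ S, classOrbitalIntegral mU f u * Γ u c) →
          ∃ (γseq : ℕ → Gqs L v) (q : ℂ) (a : ConjClasses (Gqs L v) → ℕ) (g : ConjClasses (Gqs L v) → ℂ) (n₀ : ℕ),
            (∀ n, γseq n ∈ (T : Set (Gqs L v)) ∧ IsRegularElt ((γseq n).val : GL (Fin 3) (UnitaryGroup.LocalRing L v))) ∧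
            Tendsto γseq atTop (𝓝 (1 : Gqs L v)) ∧ 1 < ‖q‖ ∧
            (∀ u ∈ S, u ≠ ConjClasses.mk 1 → 1 ≤ a u) ∧
            ∀ u ∈ S, u ≠ ConjClasses.mk 1 → ∀ n, n₀ ≤ n → Γ u (ConjClasses.mk (γseq n)) = q ^ (n * a u) * g u :=
  shalikaGermHomogeneityRay_of_scalingLaw (scalingLaw_of_transvectionHaar hC1)

set_option maxHeartbeats 3200000 in  -- statement-level `whnf` on the CM carriers (the U3 socket frame)
set_option synthInstance.maxHeartbeats 400000 in  -- idem
open Summit.HodgeConjecture.HodgeConjecture.Cruxes.H413.K2E3UnipotentOrbitalScalingTransvectionDyadicHaar in  -- [ED. 3]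
open scoped Classical in
/-- **ED. 3 · THE PAYER OF SOCKET #3H, UNCONDITIONAL: HOMOGENEITY OF THE NON-TRIVIAL SHALIKA GERMS ALONG ONE RAY OF A TYPE-(3) TORUS.**  Statement = socket U3-d ∕ #3H
`K2E3EllipticInputs.U3CubicGerms.sig_K2E3ShalikaGermHomogeneityRay` (`Cruxes/H413/Lines/K2_E3_EllipticInputsSigs_U3CubicGerms.lean` ED. 2 :101–126) TOKEN FOR TOKEN with the
Lines-side reducible `abbrev Pl L := HeightOneSpectrum (𝓞 L⁺)` inlined (tie `rfl`): for the canonical family `mQv` at a non-split `v`, a compact Cartan `T = Z(γ₀)` of type (3) and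
EVERY expansion datum `(S, mU, Γ)` at `1` (`S` unipotent, `mU` admissible on `S`, the expansion identity near `1`), there are regular `γ_n ∈ T` with `γ_n → 1`, `q` with `‖q‖ > 1`,
exponents `a u ≥ 1` and constants `g u`, `n₀` with `Γ u [γ_n] = q ^ (n·a u) · g u` for `n ≥ n₀` and every `u ∈ S ∖ {[1]}`.  Proof = the complete U3-d chain, every link ★:
ED. 2 `shalikaGermHomogeneityRay_of_transvectionHaar` (= ★ p855211 ∘ ★ p855276 ∘ ★ p855512 ∘ ★ p856049) applied to ★ p856078
`exists_haar_index_identity_of_transvection_of_two_ne_zero` (K2E4-p03 (g2): the transvection Haar-index identity `Q²·ρ(Z(u₀) ∩ hK₂h⁻¹) = ρ(Z(u₀) ∩ K₂)` at the principal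
level-2 box, every residue characteristic).  Print: [Rogawski1990] Prop. 8.1.2 (b) «`Γ_u(exp(t²Y)γ) = |t|^{−d(u)} Γ_u(exp(Y)γ)`» with uniqueness of germs (p. 113);
[HarishChandra1999] §3.1 Lemma 3.2 (homogeneity of nilpotent orbital integrals), Thm. 8.1 (1) «`Γ_O(t²H) = |t|^{r(O)−ℓ} Γ_O(H)`» — realised on the group by the Cayley scaling
`c ∘ (ϖ²·) ∘ c⁻¹` (road H-a′): `q = (#𝓀_w)^{v_w(p)}`, `a u ∈ {2, 3}` on the transvection ∕ regular unipotent classes.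
[cite: Rogawski1990, §8.1 Prop. 8.1.2 (b) p. 114; p. 113; Prop. 8.1.1 pp. 112–113; (8.1.1) p. 116] [cite: HarishChandra1999AdmissibleDistributions, §3.1 Lemma 3.2; Thm. 8.1 p. 48] -/
theorem shalikaGermHomogeneityRay :
    ∀ (L : Type) [Field L] [NumberField L] [IsCMField L] (v : HeightOneSpectrum (𝓞 ↥(maximalRealSubfield L))),
      (∀ w : PlacesOver L v, IsCMField.complexConj L • w.1 = w.1) →
      ∀ [MeasurableSpace (Gqs L v)] [BorelSpace (Gqs L v)]
        [∀ γ : Gqs L v, MeasurableSpace (Gqs L v ⧸ Subgroup.centralizer ({γ} : Set (Gqs L v)))]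
        [∀ γ : Gqs L v, BorelSpace (Gqs L v ⧸ Subgroup.centralizer ({γ} : Set (Gqs L v)))]
        (νQv : Measure (Gqs L v)) [νQv.IsHaarMeasure] [νQv.IsMulRightInvariant]
        (mQv : OrbitalMeasureFamily (Gqs L v)),
        mQv.IsCanonical (fun γ => IsRegularElt (γ.val : GL (Fin 3) (UnitaryGroup.LocalRing L v))) νQv →
        ∀ (T : Subgroup (Gqs L v)), IsCompact ((T : Subgroup (Gqs L v)) : Set (Gqs L v)) →
        ∀ (γ₀ : Gqs L v), IsRegularElt (γ₀.val : GL (Fin 3) (UnitaryGroup.LocalRing L v)) → T = Subgroup.centralizer ({γ₀} : Set (Gqs L v)) →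
        (∀ γ ∈ T, IsRegularElt (γ.val : GL (Fin 3) (UnitaryGroup.LocalRing L v)) → ∀ c : UnitaryGroup.LocalRing L v, ¬ ((γ.val.val : Matrix (Fin 3) (Fin 3) (UnitaryGroup.LocalRing L v)).charpoly).IsRoot c) →
        ∀ (S : Finset (ConjClasses (Gqs L v))) (mU : OrbitalMeasureFamily (Gqs L v)) (Γ : ConjClasses (Gqs L v) → ConjClasses (Gqs L v) → ℂ),
          (∀ u ∈ S, (((Quotient.out u : Gqs L v).val : GL (Fin 3) (UnitaryGroup.LocalRing L v)).val - 1) ^ 3 = 0) →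
          mU.IsAdmissibleOn (fun γ : Gqs L v => (ConjClasses.mk γ) ∈ S) →
          (∀ f : Gqs L v → ℂ, IsLocSmooth f →
            ∃ W ∈ 𝓝 (fun i : Fin 3 => ((1 : Matrix (Fin 3) (Fin 3) (UnitaryGroup.LocalRing L v)).charpoly).coeff i),
              ∀ c : ConjClasses (Gqs L v),
                IsRegularElt ((Quotient.out c : Gqs L v).val : GL (Fin 3) (UnitaryGroup.LocalRing L v)) →
                (fun i : Fin 3 => ((Quotient.out c : Gqs L v).val : GL (Fin 3) (UnitaryGroup.LocalRing L v)).val.charpoly.coeff i) ∈ W →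
                  classOrbitalIntegral mQv f c = ∑ u ∈ S, classOrbitalIntegral mU f u * Γ u c) →
          ∃ (γseq : ℕ → Gqs L v) (q : ℂ) (a : ConjClasses (Gqs L v) → ℕ) (g : ConjClasses (Gqs L v) → ℂ) (n₀ : ℕ),
            (∀ n, γseq n ∈ (T : Set (Gqs L v)) ∧ IsRegularElt ((γseq n).val : GL (Fin 3) (UnitaryGroup.LocalRing L v))) ∧
            Tendsto γseq atTop (𝓝 (1 : Gqs L v)) ∧ 1 < ‖q‖ ∧
            (∀ u ∈ S, u ≠ ConjClasses.mk 1 → 1 ≤ a u) ∧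
            ∀ u ∈ S, u ≠ ConjClasses.mk 1 → ∀ n, n₀ ≤ n → Γ u (ConjClasses.mk (γseq n)) = q ^ (n * a u) * g u :=
  shalikaGermHomogeneityRay_of_transvectionHaar
    (@fun _ _ _ σ _ _ _ _ _ hJ hσ hσv h2 _ ht hσt hvt _ hO _ hOm _ hF1 hFm u₀ hsq hne =>
      exists_haar_index_identity_of_transvection_of_two_ne_zero σ hJ hσ hσv h2 ht hσt hvt hO hOm hF1 hFm u₀ hsq hne)

end Summit.HodgeConjecture.HodgeConjecture.Cruxes.H413.K2E3ShalikaGermHomogeneityRay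

end
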